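/-
Copyright: the b2b-balaban cell (near-miss cell 7), T⁴-continuum fan-out; row NE7b ROUND-2 swarm, seat
t4-ne7b-formalise-leaf-05 gen 3 (row S6g′ INSTANCE of `t4/b2b-balaban-t4-ne7b-p1/LEAVES-NE7b.md`; owner's ruling
R-OWNER-22-21 (option (i): the counted member is leaf-10 gen 3's sorted twin), obligation T2's «order-sensitive clause»
alarm).  Released under the licence of the surrounding project.
-/
import Summits.QuantumFields.BalabanUV.T4Continuum.Support.HistoryRenewalsCostCanon
import Summits.QuantumFields.BalabanUV.T4Continuum.Support.HistorySiblingEntropySortInv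

/-!
# The entropy input on the SORTED twin with the renewals paid by the REALISED member's booked cost; and the booked
# reach of a same-step cluster under re-listing (row S6g′ INSTANCE, «INST-TWIN» part 1)

Summits-side support leaf of the T⁴-continuum cell (rung (B)+1 on a FINITE torus only; NOT infinite volume, NOT the
mass gap, NOT the Clay statement; NOT a proof of the spine estimate NE7b).  Row NE7b, route «COUNT», row S6g′.
[folklore] over the lineage's own carriers (`Gen.reach`, leaf-09's `chainMerge`, leaf-10 gen 3's sorted twin
`Pedigree.sortR` and its invariances `HistorySiblingEntropySortInv`); nothing is quoted from print, nothing printed is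
asserted, no `[cite:]` tag, no `Prop` fact minted, no definition.

§1 THE END.  Leaf-10 gen 3's `ENT_sortR_le` bounds the sibling entropy of the COUNTED tree `P.sortR.gen c` by the
realised pedigree's letters `2·bsum (1 + fat) + 4·partnerAges + 8·mrg + 8·NR` of `P.gen c`; `HistoryRenewalsCost`
pays `NR (P.gen c)` by the booked cost of the realised TAGGED member.  **`ENT_le_gen_sortR`**:
`(∀ c, P.HeadOldest c) → P.RenewDated → (∀ c, P.Forest c) → ConsistentTLE Prod.fst C K R (P.genT c) →
 (∀ n ≤ K, φ ≤ floorK C K R n), 0 < φ →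
 ENT PEv.step (P.sortR.gen c) ≤ 2·bsum (1 + PEv.fat) (P.gen c) + 4·partnerAges PEv.step (P.gen c)
   + 8·mrg PEv.step (P.gen c) + (8 ∕ φ)·totalCostT Prod.fst C K R (P.genT c)`; readings `_E₂`, `_pow`.

§2 THE BOOKED REACH OF A SAME-STEP CLUSTER UNDER RE-LISTING (finding F-leaf05g3-1, for obligation T2 of
R-OWNER-22-21).  With all mergers of the cluster carrying one window `w`:
* `reach_chainMerge_le_max_add`: `reach (chainMerge G Hs t) ≤ max (reach G) (max of the tail's reaches) + |Hs|·w` —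
  NO listing books more than «largest member reach + one window per merger»;
* `head_add_le_reach_chainMerge`, `first_add_le_reach_chainMerge`: the head and the FIRST tail member collect ALL
  `|Hs|` windows;
* hence **`reach_chainMerge_le_of_first_max`**: if the first tail member of a listing `Hs′` has the largest reach of
  the tail, then `reach (chainMerge G Hs t) ≤ reach (chainMerge G Hs′ t)` for EVERY listing `Hs` of the same members
  (same length, members of `Hs` among those of `Hs′`) — «largest reach first» MAXIMISES the booked reach, so the
  order-sensitive clauses of T2 (`TimedLE.alive`∕`renew_reach`, `pending`, `Gen.WF` timing: all of the form
  `… < reach` ∕ `… ≤ reach`) transfer to such a twin by MONOTONICITY;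
* §3 the toy: for a general re-listing the booked reach DOES change (`15` vs `13`, `decide`) — the recorded-shape
  order of `sortR` alone does not control it.

HONEST SCOPE.  Displays of §1 with named suppliers: `HeadOldest`∕`RenewDated`∕`Forest` (EXISTING reading
conventions of the realised pedigree), the realised member's `ConsistentTLE` (H1b), the floor bound (flow).  §2 is
bookkeeping about OUR booking rule (`Gen.reach` on a left-nested chain), not a claim about print; which canonical
listing the cell adopts (recorded-shape order, or «largest booked reach first, then recorded shape») is the owner's
ruling.  Nothing of H3∕(B)∕BetaPertH touched; `BirthShapeNodup` NOT retired by this file; NE7b NOT proved.  HONEST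
DEPENDENCY (cell): continuum YM on T⁴ ⇐ BetaPertH ∧ nine spine estimates (0/9 proved); BetaPertH ⇐ (D1) ∧ (D4) ∧
CAP+tail; G-an2-4 gates asym, D1 and NE2/3/4.  This file changes none of it.
-/

open Finset
open Literature.MathematicalPhysics.QuantumFieldTheory.Balaban1983to89
open T4PersistenceDictionary T4PrintedShapeBanking T4TaggedShapeBanking T4PartnerMultiplicity T4BranchingRecordsGas
open Summit.QuantumFields.BalabanUV.T4Continuum.LateMergers
open Summit.QuantumFields.BalabanUV.T4Continuum.HistoryBankingLE
open Summit.QuantumFields.BalabanUV.T4Continuum.HistoryJoins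
open Summit.QuantumFields.BalabanUV.T4Continuum.HistoryGen
open Summit.QuantumFields.BalabanUV.T4Continuum.HistorySiblingEntropyBridge
open Summit.QuantumFields.BalabanUV.T4Continuum.HistoryJoinsBudget (mrg)
open Summit.QuantumFields.BalabanUV.T4Continuum.HistoryJoinsEntropyBudget (ENT)
open Summit.QuantumFields.BalabanUV.T4Continuum.HistoryRenewalsCost

namespace Summit.QuantumFields.BalabanUV.T4Continuum.HistoryJoinsSortTwin

noncomputable section

/-! ## §1 The END: entropy of the counted (sorted) tree, class-linear quantities and cost of the realised member -/

section End

variable {α π : Type*} [DecidableEq α] [DecidableEq π] (P : Pedigree α π)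

/-- **`hENT` FOR THE COUNT ON THE SORTED TWIN, EVERYTHING ELSE ON THE REALISED MEMBER.**  Under the EXISTING reading
conventions `HeadOldest`, `RenewDated`, `Forest` of the realised pedigree `P`, its tagged member's `ConsistentTLE`
(H1b) and floors `≥ φ > 0` on the run:
`ENT PEv.step (P.sortR.gen c) ≤ 2·bsum (1 + PEv.fat) (P.gen c) + 4·partnerAges PEv.step (P.gen c) + 8·mrg PEv.step (P.gen c)
  + (8 ∕ φ)·totalCostT Prod.fst C K R (P.genT c)`. [folklore] -/
theorem ENT_le_gen_sortR (hH : ∀ c, P.HeadOldest c) (hR : P.RenewDated) (hF : ∀ c, P.Forest c)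
    {C : T4PrintedShapeBanking.Consts} {K : ℕ} {R : ℕ → ℕ} (hE₂ : 0 ≤ C.E₂) (hE₃ : 0 ≤ C.E₃) {φ : ℝ} (hφ0 : 0 < φ)
    (hφ : ∀ n, n ≤ K → φ ≤ floorK C K R n) (c : α) (hc : ConsistentTLE Prod.fst C K R (P.genT c)) :
    ENT PEv.step (P.sortR.gen c) ≤
      2 * bsum (fun b => (1 : ℝ) + PEv.fat b) (P.gen c) + 4 * (partnerAges PEv.step (P.gen c) : ℝ) +
        8 * mrg PEv.step (P.gen c) + 8 / φ * totalCostT Prod.fst C K R (P.genT c) := by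
  have h := ENT_sortR_le P hH hR c
  have hNR := NR_gen_le' P hF hE₂ hE₃ hφ0 hφ c hc
  have : 8 * (NR PEv.step (P.gen c) : ℝ) ≤ 8 / φ * totalCostT Prod.fst C K R (P.genT c) := by
    rw [div_mul_eq_mul_div, le_div_iff₀ hφ0]
    have := mul_le_mul_of_nonneg_left hNR (by norm_num : (0 : ℝ) ≤ 8)
    rw [mul_div_assoc'] at this
    exact (le_div_iff₀ hφ0).1 this
  linarith

/-- **READING 1** (`R ≥ 1` on the run, `E₂ > 0`). [folklore] -/
theorem ENT_le_gen_sortR_E₂ (hH : ∀ c, P.HeadOldest c) (hR : P.RenewDated) (hF : ∀ c, P.Forest c)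
    {C : T4PrintedShapeBanking.Consts} {K : ℕ} {R : ℕ → ℕ} (hE₂ : 0 < C.E₂) (hE₃ : 0 ≤ C.E₃)
    (hR1 : ∀ n, n ≤ K → 1 ≤ R n) (c : α) (hc : ConsistentTLE Prod.fst C K R (P.genT c)) :
    ENT PEv.step (P.sortR.gen c) ≤
      2 * bsum (fun b => (1 : ℝ) + PEv.fat b) (P.gen c) + 4 * (partnerAges PEv.step (P.gen c) : ℝ) +
        8 * mrg PEv.step (P.gen c) + 8 / C.E₂ * totalCostT Prod.fst C K R (P.genT c) :=
  ENT_le_gen_sortR P hH hR hF hE₂.le hE₃ hE₂ (fun n hn => E₂_le_floorK (C := C) hE₂.le hn (hR1 n hn)) c hc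

/-- **READING 2** (`R ≥ Rm > 0` on the run): renewal charge `(8 ∕ (E₂·Rm^{q′}))·totalCostT`. [folklore] -/
theorem ENT_le_gen_sortR_pow (hH : ∀ c, P.HeadOldest c) (hR : P.RenewDated) (hF : ∀ c, P.Forest c)
    {C : T4PrintedShapeBanking.Consts} {K : ℕ} {R : ℕ → ℕ} (hE₂ : 0 < C.E₂) (hE₃ : 0 ≤ C.E₃)
    {Rm : ℕ} (hRm0 : 0 < Rm) (hRm : ∀ n, n ≤ K → Rm ≤ R n) (c : α) (hc : ConsistentTLE Prod.fst C K R (P.genT c)) :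
    ENT PEv.step (P.sortR.gen c) ≤
      2 * bsum (fun b => (1 : ℝ) + PEv.fat b) (P.gen c) + 4 * (partnerAges PEv.step (P.gen c) : ℝ) +
        8 * mrg PEv.step (P.gen c) + 8 / (C.E₂ * (Rm : ℝ) ^ C.q') * totalCostT Prod.fst C K R (P.genT c) :=
  ENT_le_gen_sortR P hH hR hF hE₂.le hE₃ (by positivity)
    (fun n hn => le_floorK_of_le (C := C) hE₂.le hn (hRm n hn)) c hc

end End

/-! ## §2 The booked reach of a same-step cluster under re-listing -/

section Reach

variable {ε : Type*} (W : ε → ℕ)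

/-- **NO LISTING BOOKS MORE THAN «LARGEST MEMBER REACH + ONE WINDOW PER MERGER»**: with every merger of the chain
carrying the window `w`, `reach (chainMerge G Hs t) ≤ max (reach G) B + |Hs|·w` for any bound `B` of the tail's reaches.
[folklore] -/
theorem reach_chainMerge_le_max_add {w : ℕ} : ∀ (G : Gen ε) (Hs : List (Gen ε)) (t : ℕ → ε) (B : ℕ),
    (∀ i, W (t i) = w) → (∀ H ∈ Hs, H.reach W ≤ B) → (chainMerge G Hs t).reach W ≤ max (G.reach W) B + Hs.length * w
  | G, [], _, B, _, _ => by simp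
  | G, H :: Hs, t, B, ht, hB => by
      rw [chainMerge_cons, List.length_cons]
      have ih := reach_chainMerge_le_max_add (Gen.merge G H (t 0)) Hs (fun i => t (i + 1)) B (fun i => ht (i + 1))
        fun H' h => hB H' (List.mem_cons_of_mem _ h)
      have hH : H.reach W ≤ B := hB H List.mem_cons_self
      rw [Gen.reach_merge, ht 0] at ih
      have : max (max (G.reach W) (H.reach W) + w) B ≤ max (G.reach W) B + w := by
        rcases le_total (G.reach W) (H.reach W) with h | h
        · rw [max_eq_right h]; omega
        · rw [max_eq_left h]; omega
      calc (chainMerge (Gen.merge G H (t 0)) Hs fun i => t (i + 1)).reach W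
          ≤ max (max (G.reach W) (H.reach W) + w) B + Hs.length * w := ih
        _ ≤ max (G.reach W) B + w + Hs.length * w := by omega
        _ = max (G.reach W) B + (Hs.length + 1) * w := by ring

/-- **THE HEAD COLLECTS EVERY WINDOW**: `reach G + |Hs|·w ≤ reach (chainMerge G Hs t)`. [folklore] -/
theorem head_add_le_reach_chainMerge {w : ℕ} : ∀ (G : Gen ε) (Hs : List (Gen ε)) (t : ℕ → ε),
    (∀ i, W (t i) = w) → G.reach W + Hs.length * w ≤ (chainMerge G Hs t).reach W
  | G, [], _, _ => by simp
  | G, H :: Hs, t, ht => by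
      rw [chainMerge_cons, List.length_cons]
      have ih := head_add_le_reach_chainMerge (Gen.merge G H (t 0)) Hs (fun i => t (i + 1)) fun i => ht (i + 1)
      rw [Gen.reach_merge, ht 0] at ih
      have : G.reach W + w ≤ max (G.reach W) (H.reach W) + w := by omega
      calc G.reach W + (Hs.length + 1) * w = G.reach W + w + Hs.length * w := by ring
        _ ≤ _ := by omega

/-- **THE FIRST TAIL MEMBER COLLECTS EVERY WINDOW TOO**: `reach H + (|Hs| + 1)·w ≤ reach (chainMerge G (H :: Hs) t)`.
[folklore] -/
theorem first_add_le_reach_chainMerge {w : ℕ} (G H : Gen ε) (Hs : List (Gen ε)) (t : ℕ → ε)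
    (ht : ∀ i, W (t i) = w) : H.reach W + (Hs.length + 1) * w ≤ (chainMerge G (H :: Hs) t).reach W := by
  rw [chainMerge_cons]
  have h := head_add_le_reach_chainMerge W (Gen.merge G H (t 0)) Hs (fun i => t (i + 1)) fun i => ht (i + 1)
  rw [Gen.reach_merge, ht 0] at h
  have : H.reach W + w ≤ max (G.reach W) (H.reach W) + w := by omega
  calc H.reach W + (Hs.length + 1) * w = H.reach W + w + Hs.length * w := by ring
    _ ≤ _ := by omega

/-- **«LARGEST REACH FIRST» MAXIMISES THE BOOKED REACH.**  If the first tail member `H₁` of the listing `H₁ :: Hs′`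
dominates the reaches of all members of another listing `Hs` of the same length `|Hs| = |Hs′| + 1` (same head, same
window `w` per merger), then `reach (chainMerge G Hs t) ≤ reach (chainMerge G (H₁ :: Hs′) t′)`.  In particular every
listing of the SAME members is dominated by one that puts a member of largest reach first. [folklore] -/
theorem reach_chainMerge_le_of_first_max {w : ℕ} (G H₁ : Gen ε) (Hs Hs' : List (Gen ε)) (t t' : ℕ → ε)
    (ht : ∀ i, W (t i) = w) (ht' : ∀ i, W (t' i) = w) (hlen : Hs.length = Hs'.length + 1)
    (hmax : ∀ H ∈ Hs, H.reach W ≤ H₁.reach W) :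
    (chainMerge G Hs t).reach W ≤ (chainMerge G (H₁ :: Hs') t').reach W := by
  have h1 := reach_chainMerge_le_max_add W G Hs t (H₁.reach W) ht hmax
  have h2 := head_add_le_reach_chainMerge W G (H₁ :: Hs') t' ht'
  have h3 := first_add_le_reach_chainMerge W G H₁ Hs' t' ht'
  rw [List.length_cons] at h2
  rw [hlen] at h1
  rcases le_total (G.reach W) (H₁.reach W) with h | h
  · rw [max_eq_right h] at h1; omega
  · rw [max_eq_left h] at h1; omega

end Reach

/-! ## §3 The toy: a general re-listing changes the booked reach -/

namespace Sanity

/-- Labels `0,1,2` = three bare regions `a` (the head), `b`, `c`, all born at `0`, with birth windows `1, 1, 11`;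
labels `3,4` = two mergers at one step with window `2` each (window table `![1, 1, 11, 2, 2]`).  Listing `(a, c, b)`:
the long-lived `c` joins FIRST and collects both merger windows — booked reach `15`. [folklore] -/
example : (chainMerge (Gen.born (0 : Fin 5) 0) [Gen.born 2 0, Gen.born 1 0] (fun i => if i = 0 then 3 else 4)).reach
    (![1, 1, 11, 2, 2] : Fin 5 → ℕ) = 15 := by decide

/-- Listing `(a, b, c)` (the other tail order): `c` joins LAST and collects one window — booked reach `13 < 15`; a
history physically pending at step `13` or `14` is inside the first booking and outside the second. [folklore] -/
example : (chainMerge (Gen.born (0 : Fin 5) 0) [Gen.born 1 0, Gen.born 2 0] (fun i => if i = 0 then 3 else 4)).reach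
    (![1, 1, 11, 2, 2] : Fin 5 → ℕ) = 13 := by decide

/-- … and §2's domination at work on the toy: the «largest reach first» listing `(a, c, b)` dominates `(a, b, c)`. -/
example : (chainMerge (Gen.born (0 : Fin 5) 0) [Gen.born 1 0, Gen.born 2 0] (fun i => if i = 0 then 3 else 4)).reach
      (![1, 1, 11, 2, 2] : Fin 5 → ℕ) ≤
    (chainMerge (Gen.born (0 : Fin 5) 0) [Gen.born 2 0, Gen.born 1 0] (fun i => if i = 0 then 3 else 4)).reach
      (![1, 1, 11, 2, 2] : Fin 5 → ℕ) :=
  reach_chainMerge_le_of_first_max _ (w := 2) _ _ _ _ _ _ (fun i => by split <;> rfl)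
    (fun i => by split <;> rfl) rfl (fun H hH => by
      simp only [List.mem_cons, List.not_mem_nil, or_false] at hH
      rcases hH with rfl | rfl <;> decide)

end Sanity

end

end Summit.QuantumFields.BalabanUV.T4Continuum.HistoryJoinsSortTwin
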